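import Summits.AtomisticToContinuum.Crystallization.Theorems.ChartedZeroExcessLayeredLatticeLiouvilleZZZYRCV
import Summits.AtomisticToContinuum.Crystallization.Theorems.ChartedZeroExcessLayeredLatticeLiouvilleZZZYRCVK

/-!
# Charted zero-excess layered-lattice Liouville — ZZZYRCVL: SOUNDNESS of the king-table program, I (closed forms)

Cell `decomp-a2c`, lens 2 «structural dichotomy (special | generic)», generation 99.  «ZZZYRCVK» is the structurally recursive ℕ-program
`xiSlab K HI1 HI2 xLo yLo certs` whose five slab instances are decided by the kernel (K-files `…XiD24S0–S4`, ≈ 95 s each); «ZZZYRCV»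
(`schemeDominatedOnP_king_table`) consumes a table `T` with `Σ_{v ∈ M} kcnt v δ · kcoef F v ≤ T δ`.  This file and its sequels «ZZZYRCVM/N»
prove that the program's output IS such a table: `xiSlab … = some B ⟹ Σ_{v ∈ S} kcnt v δ · ⌈K·n(v)/F(v)⁴⌉ ≤ B[code3 δ]` for every finite set
`S` of certified members in the slab (ZZZYRCVN `xiSlab_sound`, `xiSlab_sound_real`).  Part I supplies the exact closed forms the program uses:

* §1 `xiAddAt` read-back (`getD_xiAddAt`, lengths);
* §2 coordinates `iv3 x y m = (![x, y], m)`, the king-step normal form `kstep v i = iv3 (kd v₀ i) (kd v₁ i) (kd v₂ i)` with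
  `kd d i = [i < |d|]·sign d`, and the THREE-REGION COUNT `kcnt_three` (a run count over `[0,t₁) ∪ [t₁,t₂) ∪ [t₂,n)` on which the step is constant);
* §3 ★ `kcnt_iv3`: the per-member closed form of the king run count `kcnt (x,y,m) δ` as the program's five amounts `amt3 / amt2 / amt2v / amt1 / amtv`
  (`p = min(|x|,|y|)`, `q = max`, `μ = |m|`; branches `μ ≤ p`, `p < μ ≤ q`, `q < μ`) times indicators of the five step types
  `iv3 sx sy sm`, `iv3 sx sy 0`, `dl2 x y sm`, `dl1 x y`, `iv3 0 0 sm`;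
* §4 `xiRowSums_eq`: the structural recursion `xiRowSums` is the amount-weighted sum of the coefficients `xiC K qmn q μ = ⌈K·max(q,μ)/(qmn+6μ²)⁴⌉`;
* §5 the certified vector set as the reader sees it: registry floor `xiFloor v` (`q0` on `m = 0`, `qmn + 6m²` else), ceiling `xiCeil`, membership
  `xiMember HI1 HI2 v :≡ HI1 < xiCeil v ∧ xiFloor v ≤ HI2 ∧ v ≠ 0`, coefficient `xiCoef K v = ⌈K·kingNv v/xiFloor v⁴⌉`, bin `code3 δ`, and
  `xiMember_row`: a checked row certificate `(mA, mB)` forces every member of the row to be `m = 0 ∧ cond0` or `mA ≤ |m| ≤ mB`.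

Theorem file (15 defs, 19 theorems); imports the staged ZZZYRCV, ZZZYRCVK; no instance / notation / option; 0 sorry. [g99]
-/

namespace Summit.AtomisticToContinuum.Crystallization.Theorems.ChartedZeroExcessLayeredLatticeLiouville

open scoped BigOperators

/-! ### §1 List plumbing: `xiAddAt` -/

/-- `xiAddAt` keeps the length. [g99] -/
theorem length_xiAddAt (bs : List ℕ) (k c : ℕ) : (xiAddAt bs k c).length = bs.length := by
  induction bs generalizing k with
  | nil => cases k <;> rfl
  | cons b bs ih => cases k <;> simp [xiAddAt, ih]

/-- `xiAddAt` adds `c` to entry `k` (when present) and changes nothing else. [g99] -/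
theorem getD_xiAddAt (bs : List ℕ) (k c j : ℕ) :
    (xiAddAt bs k c).getD j 0 = bs.getD j 0 + if j = k ∧ k < bs.length then c else 0 := by
  induction bs generalizing k j with
  | nil => cases k <;> simp [xiAddAt]
  | cons b bs ih =>
    cases k with
    | zero =>
      cases j with
      | zero => simp [xiAddAt]
      | succ j => simp [xiAddAt]
    | succ k =>
      cases j with
      | zero => simp [xiAddAt]
      | succ j =>
        simp only [xiAddAt, List.getD_cons_succ, ih, List.length_cons]
        by_cases h : j = k ∧ k < bs.length
        · rw [if_pos h, if_pos ⟨by omega, by omega⟩]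
        · rw [if_neg h, if_neg (fun h' => h ⟨by omega, by omega⟩)]

/-- monotone reading: an `xiAddAt` never decreases an entry, and adds `c` at `k < length`. [g99] -/
theorem getD_le_xiAddAt (bs : List ℕ) (k c j : ℕ) : bs.getD j 0 ≤ (xiAddAt bs k c).getD j 0 := by
  rw [getD_xiAddAt]; exact Nat.le_add_right _ _

/-! ### §2 Coordinates, the step normal form and the three-region count -/

/-- the index vector with coordinates `(x, y, m)`. [g99] -/
def iv3 (x y m : ℤ) : Cell 2 × ℤ := (![x, y], m)

/-- first coordinate of `iv3`. [g99] -/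
@[simp] theorem iv3_fst_zero (x y m : ℤ) : (iv3 x y m).1 0 = x := by simp [iv3]

/-- second coordinate of `iv3`. [g99] -/
@[simp] theorem iv3_fst_one (x y m : ℤ) : (iv3 x y m).1 1 = y := by simp [iv3]

/-- third coordinate of `iv3`. [g99] -/
@[simp] theorem iv3_snd (x y m : ℤ) : (iv3 x y m).2 = m := rfl

/-- every index vector is an `iv3`. [g99] -/
theorem iv3_eta (v : Cell 2 × ℤ) : iv3 (v.1 0) (v.1 1) v.2 = v := by
  refine Prod.ext (funext fun k => ?_) rfl
  fin_cases k <;> simp [iv3]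

/-- equality of `iv3`s is coordinatewise. [g99] -/
theorem iv3_inj {x y m x' y' m' : ℤ} : iv3 x y m = iv3 x' y' m' ↔ x = x' ∧ y = y' ∧ m = m' := by
  constructor
  · intro h
    have h1 := congrArg (fun v : Cell 2 × ℤ => v.1 0) h
    have h2 := congrArg (fun v : Cell 2 × ℤ => v.1 1) h
    have h3 := congrArg (fun v : Cell 2 × ℤ => v.2) h
    simp at h1 h2 h3
    exact ⟨h1, h2, h3⟩
  · rintro ⟨rfl, rfl, rfl⟩; rfl

/-- the one-coordinate king step: `sign d` while `i < |d|`, then `0`. [g99] -/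
def kd (d : ℤ) (i : ℕ) : ℤ := if i < d.natAbs then Int.sign d else 0

/-- ★ STEP NORMAL FORM: `kstep v i = (kd v₀ i, kd v₁ i, kd v₂ i)`. [g99] -/
theorem kstep_eq_iv3 (v : Cell 2 × ℤ) (i : ℕ) : kstep v i = iv3 (kd (v.1 0) i) (kd (v.1 1) i) (kd v.2 i) := by
  have h := kstep_apply v i
  rw [← iv3_eta (kstep v i)]
  refine iv3_inj.mpr ⟨?_, ?_, ?_⟩
  · rw [h.1 0, kpos_succ_sub]; rfl
  · rw [h.1 1, kpos_succ_sub]; rfl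
  · rw [h.2, kpos_succ_sub]; rfl

/-- `kingNv` in coordinates. [g99] -/
theorem kingNv_iv3 (x y m : ℤ) : kingNv (iv3 x y m) = max (max x.natAbs y.natAbs) m.natAbs := by
  simp [kingNv]

/-- ★ THE THREE-REGION COUNT: if the king step of `v` is constant `δ₁ / δ₂ / δ₃` on `[0,t₁) / [t₁,t₂) / [t₂,n)` (`n = kingNv v`), then
`kcnt v δ = t₁·[δ₁ = δ] + (t₂ − t₁)·[δ₂ = δ] + (n − t₂)·[δ₃ = δ]` (indicators written `if _ then 1 else 0`). [g99] -/
theorem kcnt_three {v : Cell 2 × ℤ} {t1 t2 : ℕ} (h12 : t1 ≤ t2) (h2n : t2 ≤ kingNv v) (δ1 δ2 δ3 : Cell 2 × ℤ)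
    (r1 : ∀ i, i < t1 → kstep v i = δ1) (r2 : ∀ i, t1 ≤ i → i < t2 → kstep v i = δ2)
    (r3 : ∀ i, t2 ≤ i → i < kingNv v → kstep v i = δ3) (δ : Cell 2 × ℤ) :
    kcnt v δ = t1 * (if δ1 = δ then 1 else 0) + (t2 - t1) * (if δ2 = δ then 1 else 0) +
      (kingNv v - t2) * (if δ3 = δ then 1 else 0) := by
  classical
  unfold kcnt
  rw [Finset.card_filter, Finset.range_eq_Ico]
  rw [← Finset.sum_Ico_consecutive _ (Nat.zero_le t1) (h12.trans h2n), ← Finset.sum_Ico_consecutive _ h12 h2n]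
  have e1 : (∑ i ∈ Finset.Ico 0 t1, if kstep v i = δ then 1 else 0) = ∑ i ∈ Finset.Ico 0 t1, if δ1 = δ then 1 else 0 :=
    Finset.sum_congr rfl fun i hi => by rw [r1 i (Finset.mem_Ico.mp hi).2]
  have e2 : (∑ i ∈ Finset.Ico t1 t2, if kstep v i = δ then 1 else 0) = ∑ i ∈ Finset.Ico t1 t2, if δ2 = δ then 1 else 0 :=
    Finset.sum_congr rfl fun i hi => by rw [r2 i (Finset.mem_Ico.mp hi).1 (Finset.mem_Ico.mp hi).2]
  have e3 : (∑ i ∈ Finset.Ico t2 (kingNv v), if kstep v i = δ then 1 else 0) =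
      ∑ i ∈ Finset.Ico t2 (kingNv v), if δ3 = δ then 1 else 0 :=
    Finset.sum_congr rfl fun i hi => by rw [r3 i (Finset.mem_Ico.mp hi).1 (Finset.mem_Ico.mp hi).2]
  rw [e1, e2, e3, Finset.sum_const, Finset.sum_const, Finset.sum_const, Nat.card_Ico, Nat.card_Ico, Nat.card_Ico,
    smul_eq_mul, smul_eq_mul, smul_eq_mul, Nat.sub_zero]
  ring


/-! ### §3 The per-member closed form (three branches `|m| ≤ p`, `p < |m| ≤ q`, `q < |m|`) -/

/-- `kd` below the threshold. [g99] -/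
theorem kd_of_lt {d : ℤ} {i : ℕ} (h : i < d.natAbs) : kd d i = Int.sign d := if_pos h

/-- `kd` at or above the threshold. [g99] -/
theorem kd_of_le {d : ℤ} {i : ℕ} (h : d.natAbs ≤ i) : kd d i = 0 := if_neg (Nat.not_lt.mpr h)

/-- the king step of `iv3 x y m` in coordinates. [g99] -/
theorem kstep_iv3 (x y m : ℤ) (i : ℕ) : kstep (iv3 x y m) i = iv3 (kd x i) (kd y i) (kd m i) := by
  rw [kstep_eq_iv3]; simp

/-- amount: steps on which all three coordinates move (`min(|m|, p)`). [g99] -/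
def amt3 (p μ : ℕ) : ℕ := if μ ≤ p then μ else p

/-- amount: steps on which exactly the two in-plane coordinates move (`p ∸ |m|`). [g99] -/
def amt2 (p μ : ℕ) : ℕ := if μ ≤ p then p - μ else 0

/-- amount: steps on which the larger in-plane coordinate and the vertical one move (`min(q,|m|) ∸ p`). [g99] -/
def amt2v (p q μ : ℕ) : ℕ := if μ ≤ p then 0 else if μ ≤ q then μ - p else q - p

/-- amount: steps on which only the larger in-plane coordinate moves (`q ∸ max(p,|m|)`). [g99] -/
def amt1 (p q μ : ℕ) : ℕ := if μ ≤ p then q - p else if μ ≤ q then q - μ else 0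

/-- amount: steps on which only the vertical coordinate moves (`|m| ∸ q`). [g99] -/
def amtv (p q μ : ℕ) : ℕ := if μ ≤ p then 0 else if μ ≤ q then 0 else μ - q

/-- step type «larger in-plane coordinate alone» (the program's `c1`; ties resolved towards `x`). [g99] -/
noncomputable def dl1 (x y : ℤ) : Cell 2 × ℤ :=
  if y.natAbs ≤ x.natAbs then iv3 (Int.sign x) 0 0 else iv3 0 (Int.sign y) 0

/-- step type «larger in-plane coordinate with the vertical step `σ`» (the program's `c2u / c2d`). [g99] -/
noncomputable def dl2 (x y σ : ℤ) : Cell 2 × ℤ :=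
  if y.natAbs ≤ x.natAbs then iv3 (Int.sign x) 0 σ else iv3 0 (Int.sign y) σ

/-- ★ THE PER-MEMBER CLOSED FORM of the king run count of `v = (x, y, m)` with `p = min(|x|,|y|)`, `q = max(|x|,|y|)`, `μ = |m|`:
`kcnt v δ = amt3·[(sx,sy,sm) = δ] + amt2·[(sx,sy,0) = δ] + amt2v·[dl2 = δ] + amt1·[dl1 = δ] + amtv·[(0,0,sm) = δ]`. [g99] -/
theorem kcnt_iv3 (x y m : ℤ) (δ : Cell 2 × ℤ) :
    kcnt (iv3 x y m) δ =
      amt3 (min x.natAbs y.natAbs) m.natAbs * (if iv3 (Int.sign x) (Int.sign y) (Int.sign m) = δ then 1 else 0) +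
      amt2 (min x.natAbs y.natAbs) m.natAbs * (if iv3 (Int.sign x) (Int.sign y) 0 = δ then 1 else 0) +
      amt2v (min x.natAbs y.natAbs) (max x.natAbs y.natAbs) m.natAbs * (if dl2 x y (Int.sign m) = δ then 1 else 0) +
      amt1 (min x.natAbs y.natAbs) (max x.natAbs y.natAbs) m.natAbs * (if dl1 x y = δ then 1 else 0) +
      amtv (min x.natAbs y.natAbs) (max x.natAbs y.natAbs) m.natAbs * (if iv3 0 0 (Int.sign m) = δ then 1 else 0) := by
  set p := min x.natAbs y.natAbs with hp
  set q := max x.natAbs y.natAbs with hq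
  set μ := m.natAbs with hμ
  have hn : kingNv (iv3 x y m) = max q μ := by rw [kingNv_iv3]
  -- region facts
  have F1 : ∀ i, i < p → i < μ → kstep (iv3 x y m) i = iv3 (Int.sign x) (Int.sign y) (Int.sign m) := by
    intro i h1 h2; rw [kstep_iv3, kd_of_lt (by omega), kd_of_lt (by omega), kd_of_lt (by omega)]
  have F2 : ∀ i, μ ≤ i → i < p → kstep (iv3 x y m) i = iv3 (Int.sign x) (Int.sign y) 0 := by
    intro i h1 h2; rw [kstep_iv3, kd_of_lt (by omega), kd_of_lt (by omega), kd_of_le (by omega)]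
  have F3 : ∀ i, p ≤ i → i < q → μ ≤ i → kstep (iv3 x y m) i = dl1 x y := by
    intro i h1 h2 h3; rw [kstep_iv3]; unfold dl1
    split_ifs with hxy
    · rw [kd_of_lt (by omega), kd_of_le (by omega), kd_of_le (by omega)]
    · rw [kd_of_le (by omega), kd_of_lt (by omega), kd_of_le (by omega)]
  have F4 : ∀ i, p ≤ i → i < q → i < μ → kstep (iv3 x y m) i = dl2 x y (Int.sign m) := by
    intro i h1 h2 h3; rw [kstep_iv3]; unfold dl2
    split_ifs with hxy
    · rw [kd_of_lt (by omega), kd_of_le (by omega), kd_of_lt (by omega)]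
    · rw [kd_of_le (by omega), kd_of_lt (by omega), kd_of_lt (by omega)]
  have F5 : ∀ i, q ≤ i → i < μ → kstep (iv3 x y m) i = iv3 0 0 (Int.sign m) := by
    intro i h1 h2; rw [kstep_iv3, kd_of_le (by omega), kd_of_le (by omega), kd_of_lt (by omega)]
  by_cases hA : μ ≤ p
  · -- branch 1: regions [0,μ) [μ,p) [p,q)
    have h := kcnt_three (v := iv3 x y m) (t1 := μ) (t2 := p) hA (by rw [hn]; omega) _ _ _
      (fun i hi => F1 i (by omega) hi) (fun i h1 h2 => F2 i h1 h2)
      (fun i h1 h2 => F3 i h1 (by rw [hn] at h2; omega) (by omega)) δ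
    rw [h, hn]
    simp only [amt3, amt2, amt2v, amt1, amtv, if_pos hA, zero_mul, add_zero]
    have : max q μ - p = q - p := by omega
    rw [this]
  · by_cases hB : μ ≤ q
    · -- branch 2: regions [0,p) [p,μ) [μ,q)
      have h := kcnt_three (v := iv3 x y m) (t1 := p) (t2 := μ) (by omega) (by rw [hn]; omega) _ _ _
        (fun i hi => F1 i hi (by omega)) (fun i h1 h2 => F4 i h1 (by omega) h2)
        (fun i h1 h2 => F3 i (by omega) (by rw [hn] at h2; omega) h1) δ
      rw [h, hn]
      simp only [amt3, amt2, amt2v, amt1, amtv, if_neg hA, if_pos hB, zero_mul, add_zero]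
      have : max q μ - μ = q - μ := by omega
      rw [this]
    · -- branch 3: regions [0,p) [p,q) [q,μ)
      have h := kcnt_three (v := iv3 x y m) (t1 := p) (t2 := q) (by omega) (by rw [hn]; omega) _ _ _
        (fun i hi => F1 i hi (by omega)) (fun i h1 h2 => F4 i h1 h2 (by omega))
        (fun i h1 h2 => F5 i h1 (by rw [hn] at h2; omega)) δ
      rw [h, hn]
      simp only [amt3, amt2, amt2v, amt1, amtv, if_neg hA, if_neg hB, zero_mul, add_zero]
      have : max q μ - q = μ - q := by omega
      rw [this]

/-! ### §4 The row sums are the amount-weighted coefficient sums -/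

/-- the program's per-member coefficient `⌈K·max(q, μ)/(qmn + 6μ²)⁴⌉`. [g99] -/
def xiC (K qmn q μ : ℕ) : ℕ := (K * max q μ + (qmn + 6 * μ * μ) ^ 4 - 1) / (qmn + 6 * μ * μ) ^ 4

/-- ★ `xiRowSums` in closed form: component `r` is `Σ_{j < len} amt_r(mA + j) · xiC(mA + j)`. [g99] -/
theorem xiRowSums_eq (K qmn p q mA len : ℕ) :
    xiRowSums K qmn p q mA len =
      (∑ j ∈ Finset.range len, amt3 p (mA + j) * xiC K qmn q (mA + j),
       ∑ j ∈ Finset.range len, amt2 p (mA + j) * xiC K qmn q (mA + j),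
       ∑ j ∈ Finset.range len, amt2v p q (mA + j) * xiC K qmn q (mA + j),
       ∑ j ∈ Finset.range len, amt1 p q (mA + j) * xiC K qmn q (mA + j),
       ∑ j ∈ Finset.range len, amtv p q (mA + j) * xiC K qmn q (mA + j)) := by
  induction len with
  | zero => simp [xiRowSums]
  | succ len ih =>
    simp only [xiRowSums, ih, Finset.sum_range_succ]
    by_cases h1 : mA + len ≤ p
    · rw [if_pos h1]
      simp only [amt3, amt2, amt2v, amt1, amtv, if_pos h1, xiC, zero_mul, add_zero]
    · rw [if_neg h1]
      by_cases h2 : mA + len ≤ q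
      · rw [if_pos h2]
        simp only [amt3, amt2, amt2v, amt1, amtv, if_neg h1, if_pos h2, xiC, zero_mul, add_zero]
      · rw [if_neg h2]
        simp only [amt3, amt2, amt2v, amt1, amtv, if_neg h1, if_neg h2, xiC, zero_mul, add_zero]

/-! ### §5 The certified vector set: registry floor / ceiling, membership, coefficient -/

/-- ★ registry floor `F(v)` of `9|ideal e_v|²` (`+ 6Δm²`; same layer ⇒ offset `0`). [g99] -/
def xiFloor (v : Cell 2 × ℤ) : ℕ :=
  if v.2 = 0 then xiQ0 (v.1 0) (v.1 1) else xiQmn (v.1 0) (v.1 1) + 6 * v.2.natAbs * v.2.natAbs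

/-- ★ registry ceiling `Fmax(v)` of `9|ideal e_v|²`. [g99] -/
def xiCeil (v : Cell 2 × ℤ) : ℕ :=
  if v.2 = 0 then xiQ0 (v.1 0) (v.1 1) else xiQmx (v.1 0) (v.1 1) + 6 * v.2.natAbs * v.2.natAbs

/-- ★ MEMBERSHIP of the middle vector set `M = {v ≠ 0 : Fmax(v) > HI1 ∧ F(v) ≤ HI2}`. [g99] -/
def xiMember (HI1 HI2 : ℕ) (v : Cell 2 × ℤ) : Prop := HI1 < xiCeil v ∧ xiFloor v ≤ HI2 ∧ v ≠ 0

/-- ★ the integer coefficient `⌈K·n(v)/F(v)⁴⌉`. [g99] -/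
def xiCoef (K : ℕ) (v : Cell 2 × ℤ) : ℕ := (K * kingNv v + xiFloor v ^ 4 - 1) / xiFloor v ^ 4

/-- the step code of an index vector (bins are indexed by it). [g99] -/
def code3 (δ : Cell 2 × ℤ) : ℕ := xiDcode (δ.1 0) (δ.1 1) δ.2

/-- coefficient of a member with `m ≠ 0`: the program's `xiC`. [g99] -/
theorem xiCoef_iv3 (K : ℕ) (x y m : ℤ) (hm : m ≠ 0) :
    xiCoef K (iv3 x y m) = xiC K (xiQmn x y) (max x.natAbs y.natAbs) m.natAbs := by
  simp [xiCoef, xiC, xiFloor, kingNv_iv3, hm]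

/-- coefficient of the member with `m = 0`: the program's `c0`. [g99] -/
theorem xiCoef_iv3_zero (K : ℕ) (x y : ℤ) :
    xiCoef K (iv3 x y 0) = (K * max x.natAbs y.natAbs + xiQ0 x y ^ 4 - 1) / xiQ0 x y ^ 4 := by
  simp [xiCoef, xiFloor, kingNv_iv3]

/-- ★ CERTIFICATE SOUNDNESS: under the four checked inequalities of `xiRowC`, a member `(x, y, m)` of the row has `m = 0` (and then
`HI1 < q0 ≤ HI2`, `(x, y) ≠ 0`) or `mA ≤ |m| ≤ mB` (only two of them are needed for this direction). [g99] -/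
theorem xiMember_row {HI1 HI2 : ℕ} {x y m : ℤ} {mA mB : ℕ} (h1 : 1 ≤ mA)
    (h3 : mA = 1 ∨ xiQmx x y + 6 * (mA - 1) * (mA - 1) ≤ HI1) (h4 : HI2 < xiQmn x y + 6 * (mB + 1) * (mB + 1))
    (hv : xiMember HI1 HI2 (iv3 x y m)) :
    (m = 0 ∧ HI1 < xiQ0 x y ∧ xiQ0 x y ≤ HI2 ∧ ¬(x = 0 ∧ y = 0)) ∨ (m ≠ 0 ∧ mA ≤ m.natAbs ∧ m.natAbs ≤ mB) := by
  rcases hv with ⟨hc, hf, hne⟩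
  by_cases hm : m = 0
  · left
    subst hm
    simp only [xiCeil, xiFloor, iv3_snd, iv3_fst_zero, iv3_fst_one, if_true] at hc hf
    refine ⟨rfl, hc, hf, fun hxy => hne ?_⟩
    rw [hxy.1, hxy.2]
    refine Prod.ext (funext fun k => ?_) rfl
    fin_cases k <;> simp
  · right
    simp only [xiCeil, xiFloor, iv3_snd, iv3_fst_zero, iv3_fst_one, hm, if_false] at hc hf
    simp only [Nat.mul_assoc] at h3 h4 hc hf
    have hμ1 : 1 ≤ m.natAbs := Int.natAbs_pos.mpr hm
    refine ⟨hm, ?_, ?_⟩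
    · by_contra hlt
      have hlt' := Nat.not_le.mp hlt
      rcases h3 with h3 | h3
      · omega
      · have : m.natAbs * m.natAbs ≤ (mA - 1) * (mA - 1) := Nat.mul_self_le_mul_self (by omega)
        omega
    · by_contra hlt
      have hlt' := Nat.not_le.mp hlt
      have : (mB + 1) * (mB + 1) ≤ m.natAbs * m.natAbs := Nat.mul_self_le_mul_self (by omega)
      omega

end Summit.AtomisticToContinuum.Crystallization.Theorems.ChartedZeroExcessLayeredLatticeLiouville
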